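import Summits.FinalStateConjecture.FinalStateConjecture.Theses.ZeroEnergyKerrOrBomb
import Summits.FinalStateConjecture.FinalStateConjecture.Theorems.ZeroEnergyKerrOrBombErgoregionBombModTOffWallReduction
import Summits.FinalStateConjecture.FinalStateConjecture.Theorems.ZeroEnergyKerrOrBombKerrOrBombModTOfCruxes

/-!
# RESTATE KIT for crux `ErgoregionBombModT` (stmt-FinalStateConjecture-17838) — lead c4, 2026-08-17

Kernel-checked form of the restate recommended by leads c1–c4 of line `killing-light-points`
(crux NOTES.md, Lines/killing-light-points.md): replace the crux `ErgoregionBombModT` (rank 3) by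

* `OffWallBomb` — the crux restricted to trapped zero-energy rays ENTERING the open ergoregion
  `{g(T,T) > 0}` (body = registered stub `stub_offWallBomb` = hypothesis `hOff` of the landed
  reduction `ergoregionBombModT_of_offWall_of_noDocLightPoints`, p135563, VERBATIM), the honest
  bomb conjecture (crux-sized, XL/open); and
* `NoDocLightPoints` — "no Killing light point in the d.o.c. of a telescope hole" (body =
  hypothesis `hNo` of p135563 VERBATIM), a uniqueness-type statement to be SHARED with
  `NonTrappingHawkingRigidity` (stmt-13896), on whose side it is free
  (`noDocLightPoints_of_nonTrapping`, p139708); true on Kerr; its would-be violators are the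
  light-point species certified in p138761/p139117 (inhabit the antecedent), p141962 (evanescent:
  bomb without ergoregion), p144151/p143801 (evanescent: algebraically special, `□g(T,T) = 0`;
  hovering: `□g(T,T) ≥ 0`), EvanescentTwist (twist-free).

The two theorems below show that NOTHING ELSE in the route changes: the deciding theorem `closes`
and the support `KerrOrBombModTOfCruxes` go through with `(hA : OffWallBomb) (hW : NoDocLightPoints)`
in place of `(hB : ErgoregionBombModT)`, via the landed glue.  This is a crux WORKFILE (it imports
the Theses file); the planner's `route edit --closes-file` re-renders the same proof against the
restated items.
-/

noncomputable section

-- summit = problem name (D-0017)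
set_option linter.dupNamespace false

open scoped Manifold Topology
open Set

namespace Summit.FinalStateConjecture.FinalStateConjecture.Cruxes.ErgoregionBombModT.RestateKit

open Summit.FinalStateConjecture.FinalStateConjecture.Theses.ZeroEnergyKerrOrBomb
open Summit.FinalStateConjecture.FinalStateConjecture.Theorems

/-- **Proposed restated crux `OffWallBomb`** (= registered `stub_offWallBomb` of line
`killing-light-points` = hypothesis `hOff` of p135563, verbatim): in the telescope, a maximal
zero-energy null geodesic trapped modulo the flow which ENTERS `{g(T,T) > 0}` at some parameter
forces the growing Killing-mode pair. -/
def OffWallBomb : Prop :=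
  ∀ (𝓑 : Literature.Geometry.Lorentzian.StationaryAFBlackHole.{0}) [𝓑.metric.HasLeviCivita] [Literature.Geometry.Lorentzian.Kerr.Facts], 𝓑.metric.toPseudoRiemannianMetric.IsRicciFlat → 𝓑.IsIPlusRegular → (∀ p : 𝓑.carrier, p ∈ 𝓑.metric.chronologicalFuture 𝓑.timeOrientation 𝓑.Mext) → (∀ p ∈ 𝓑.doc, 𝓑.killing p ≠ 0) → SimplyConnectedSpace 𝓑.doc → ∀ (U : Set 𝓑.carrier) (K : Π x : 𝓑.carrier, TangentSpace (𝓡 4) x), IsOpen U → 𝓑.horizon ⊆ U → IsConnected 𝓑.horizon → ContMDiffOn (𝓡 4) ((𝓡 4).prod 𝓘(ℝ, Literature.Geometry.Lorentzian.E4)) ((⊤ : ℕ∞) : WithTop ℕ∞) (fun x ↦ (Bundle.TotalSpace.mk' Literature.Geometry.Lorentzian.E4 x (K x) : TangentBundle (𝓡 4) 𝓑.carrier)) U → (∀ x ∈ U, ∀ v w : TangentSpace (𝓡 4) x, 𝓑.metric.val x (𝓑.metric.leviCivita K x v) w + 𝓑.metric.val x v (𝓑.metric.leviCivita K x w) = 0)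 → (∀ x ∈ U, VectorField.mlieBracket (𝓡 4) 𝓑.killing K x = 0) → (∀ p ∈ 𝓑.horizon, K p ≠ 0) → (∀ γ : ℝ → 𝓑.carrier, IsMIntegralCurve γ K → γ 0 ∈ 𝓑.horizon → ∀ t, γ t ∈ 𝓑.horizon) → (∀ x ∈ U ∩ 𝓑.doc, 𝓑.metric.val x (K x) (K x) < 0) → (∃ S₀ : Set 𝓑.carrier, IsCompact S₀ ∧ S₀ ⊆ 𝓑.doc ∧ ∀ y ∈ 𝓑.doc, 0 ≤ 𝓑.metric.val y (𝓑.killing y) (𝓑.killing y) → y ∉ U → y ∈ Literature.Geometry.Lorentzian.stationaryOrbit 𝓑.killing S₀) → ∀ S : Set 𝓑.carrier, IsCompact S → S ⊆ 𝓑.doc → ∀ (γ : ℝ → 𝓑.carrier) (s : Set ℝ), Literature.Geometry.Lorentzian.IsMaximalGeodesicOn 𝓑.metric.toPseudoRiemannianMetric.leviCivita γ s → s.Nonempty → (∀ t ∈ s, 𝓑.metric.val (γ t) (Literature.Geometry.Lorentzian.velocity (𝓡 4) γ t) (Literature.Geometry.Lorentzian.velocity (𝓡 4) γ t) = 0 ∧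 Literature.Geometry.Lorentzian.velocity (𝓡 4) γ t ≠ 0 ∧ 𝓑.metric.val (γ t) (Literature.Geometry.Lorentzian.velocity (𝓡 4) γ t) (𝓑.killing (γ t)) = 0) → (∀ t ∈ s, γ t ∈ Literature.Geometry.Lorentzian.stationaryOrbit 𝓑.killing S) → (∃ t ∈ s, 0 < 𝓑.metric.val (γ t) (𝓑.killing (γ t)) (𝓑.killing (γ t))) → ∃ (ν ω : ℝ) (ψ χ : 𝓑.carrier → ℝ), 0 < ν ∧ (∃ U : Set 𝓑.carrier, IsOpen U ∧ 𝓑.doc ∪ 𝓑.horizon ⊆ U ∧ ContMDiffOn (𝓡 4) 𝓘(ℝ, ℝ) ((⊤ : ℕ∞) : WithTop ℕ∞) ψ U ∧ ContMDiffOn (𝓡 4) 𝓘(ℝ, ℝ) ((⊤ : ℕ∞) : WithTop ℕ∞) χ U) ∧ (∀ x ∈ 𝓑.doc, 𝓑.metric.dalembertian ψ x = 0 ∧ 𝓑.metric.dalembertian χ x = 0) ∧ (∀ x ∈ 𝓑.doc, mfderiv (𝓡 4) 𝓘(ℝ, ℝ) ψ x (𝓑.killing x) = ν * ψ x - ω *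 χ x ∧ mfderiv (𝓡 4) 𝓘(ℝ, ℝ) χ x (𝓑.killing x) = ω * ψ x + ν * χ x) ∧ (∃ C : ℝ, ∀ x ∈ 𝓑.doc ∩ 𝓑.metric.chronologicalPast 𝓑.timeOrientation (𝓑.embed '' 𝓑.e.far (𝓑.e.R + 1)), |ψ x| ≤ C ∧ |χ x| ≤ C) ∧ ∃ x ∈ 𝓑.doc, ψ x ≠ 0 ∨ χ x ≠ 0

/-- **Proposed shared item `NoDocLightPoints`** (= hypothesis `hNo` of p135563, verbatim): in the
telescope, no point `p` of the d.o.c. with `g(T,T)(p) = 0` has `∇_T T = κ T` (no Killing light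
point in the d.o.c.). -/
def NoDocLightPoints : Prop :=
  ∀ (𝓑 : Literature.Geometry.Lorentzian.StationaryAFBlackHole.{0}) [𝓑.metric.HasLeviCivita] [Literature.Geometry.Lorentzian.Kerr.Facts], 𝓑.metric.toPseudoRiemannianMetric.IsRicciFlat → 𝓑.IsIPlusRegular → (∀ p : 𝓑.carrier, p ∈ 𝓑.metric.chronologicalFuture 𝓑.timeOrientation 𝓑.Mext) → (∀ p ∈ 𝓑.doc, 𝓑.killing p ≠ 0) → SimplyConnectedSpace 𝓑.doc → ∀ (U : Set 𝓑.carrier) (K : Π x : 𝓑.carrier, TangentSpace (𝓡 4) x), IsOpen U → 𝓑.horizon ⊆ U → IsConnected 𝓑.horizon → ContMDiffOn (𝓡 4) ((𝓡 4).prod 𝓘(ℝ, Literature.Geometry.Lorentzian.E4)) ((⊤ : ℕ∞) : WithTop ℕ∞) (fun x ↦ (Bundle.TotalSpace.mk' Literature.Geometry.Lorentzian.E4 x (K x) : TangentBundle (𝓡 4) 𝓑.carrier)) U → (∀ x ∈ U, ∀ v w : TangentSpace (𝓡 4) x, 𝓑.metric.val x (𝓑.metric.leviCivita K x v) w + 𝓑.metric.val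 x v (𝓑.metric.leviCivita K x w) = 0) → (∀ x ∈ U, VectorField.mlieBracket (𝓡 4) 𝓑.killing K x = 0) → (∀ p ∈ 𝓑.horizon, K p ≠ 0) → (∀ γ : ℝ → 𝓑.carrier, IsMIntegralCurve γ K → γ 0 ∈ 𝓑.horizon → ∀ t, γ t ∈ 𝓑.horizon) → (∀ x ∈ U ∩ 𝓑.doc, 𝓑.metric.val x (K x) (K x) < 0) → (∃ S₀ : Set 𝓑.carrier, IsCompact S₀ ∧ S₀ ⊆ 𝓑.doc ∧ ∀ y ∈ 𝓑.doc, 0 ≤ 𝓑.metric.val y (𝓑.killing y) (𝓑.killing y) → y ∉ U → y ∈ Literature.Geometry.Lorentzian.stationaryOrbit 𝓑.killing S₀) → ∀ p ∈ 𝓑.doc, 𝓑.metric.val p (𝓑.killing p) (𝓑.killing p) = 0 → ∀ κ : ℝ, 𝓑.metric.leviCivita 𝓑.killing p (𝓑.killing p) ≠ κ • 𝓑.killing p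

/-- The crux as filed follows from the two restated items (landed glue p135563). -/
theorem ergoregionBombModT_of_restated (hA : OffWallBomb) (hW : NoDocLightPoints) :
    ErgoregionBombModT :=
  ErgoregionBombModT.ergoregionBombModT_of_offWall_of_noDocLightPoints hA hW

/-- **The route's deciding theorem with the restated items**: same conclusion, same other cruxes. -/
theorem closes_restated (hN : NonTrappingHawkingRigidity) (hA : OffWallBomb) (hW : NoDocLightPoints)
    (hF : FinalStateFromKerrOrBomb) (hD : HawkingExtensionIsKerr) : _root_.FinalStateConjecture :=
  closes hN (ergoregionBombModT_of_restated hA hW) hF hD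

/-- **The target with the restated items** (support `KerrOrBombModTOfCruxes`, proved p-landed as
`KerrOrBombModTOfCruxes_proof`). -/
theorem kerrOrBombModT_of_restated (hN : NonTrappingHawkingRigidity) (hD : HawkingExtensionIsKerr)
    (hA : OffWallBomb) (hW : NoDocLightPoints) : KerrOrBombModT :=
  KerrOrBombModTOfCruxes_proof hN hD (ergoregionBombModT_of_restated hA hW)

end Summit.FinalStateConjecture.FinalStateConjecture.Cruxes.ErgoregionBombModT.RestateKit

end
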